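import Literature.AlgebraicGeometry.Modules.SerreTwistOneOfFrameSections
import Literature.AlgebraicGeometry.Modules.IsoOfFrames
import HarnessLib

/-!
# `E ≅ ι_E^*𝒪(1)` WITH `s_i ↦ x_i|_X` (Hartshorne II Thm. 7.1 (a), the section clause, in the Serre-twist currency)

Layer `Literature/AlgebraicGeometry/Modules`, namespace `Literature.AlgebraicGeometry.Modules` (§1–§2) and `….SerreTwist` (§3–§4).
THEOREMS ONLY (no definition, no instance, no notation, no named fact, no `sorry`).  Cell `hodgecm-mathlib` (D-0151), F-DAG F-6 (H-rep)
V-brick, the SECTION CLAUSE asked for by R-B `AbelianSchemes/MFKIntrinsicOfLinearRigidification` (B-p18 (g19) cut, B-plan1 (g17)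
2026-08-30: «REQUIRED»); sibling of ★ `Modules/SerreTwistOneOfFrameSections` (the `Nonempty` form).  Count-neutral Mathlib-side capital:
HC_CM is proved only modulo the 7 printed citations until rung 0 closes — nothing here bears on a summit statement.

For an `𝒪_X`-module `E` with a rank-one frame system `F`, global sections `s₀, …, s_r` whose non-vanishing loci cover, and the morphism
`φ : X → 𝐏ʳ_A` they define, [Hartshorne1977] II Thm. 7.1 (a) gives an isomorphism `E ≅ φ^*𝒪(1)` UNDER WHICH `s_i ↔ φ^*x_i`.  Here the
isomorphism is produced with its formula, by the tree's «frames on a common cover with equal transition matrices» gluing (★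
`Modules/IsoOfFrames.isoOfFrames`, [Hartshorne1977] II Ex. 5.18 (c)) instead of the cocycle classification used for the `Nonempty` form:

* §1 frames from ONE generating section: `isIso_smulSection_of_bijective` (★ `smulSection b : 𝒪|_W → M|_W`, `r ↦ r • b`, is an
  isomorphism as soon as it is bijective on sections — isomorphisms of sheaves of modules are detected objectwise), the basis section of
  `freePUnitIso W ≪≫ asIso (smulSection b)` is `b`, and the `1 × 1` transition matrix of two such frames is the ratio `t` with
  `b'|_V = t • b|_V` (`transition_smulSection_eq`);
* §2 `bijective_smul_of_eq_unit_smul_gen` — a unit multiple of the local generator of a rank-one frame generates freely;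
* §3 `SerreTwist.bijective_smul_map_monomialSection_one` — `x_a|_V` generates `𝒪_X(1)|_V` freely on `V ⊆ φ⁻¹D₊(x_a)` ((L1) ★
  `eq_comp_smul_monomialSection`), and `x_i|_V = (x_i/x_a)|_V • x_a|_V` (`map_monomialSection_one_eq_map_chartFun_smul'`);
* §4 HEADS: the criterion **`exists_iso_twistMod_one_of_coeffAt`** (hypotheses of ★ `nonempty_iso_twistMod_one_of_coeffAt`; frames
  `s_{j x}|` of `E` and `x_{j x}|` of `𝒪_X(1)` on `W_x = φ⁻¹D₊(x_{j x}) ∩ U_x` have the same transition function `x_{j y}/x_{j x}`, so ★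
  `isoOfFrames` glues `s_{j x}| ↦ x_{j x}|`, whence `s_i ↦ x_i` by `s_i| = (x_i/x_{j x}) s_{j x}|` and sheaf separation), and its
  instances **`exists_iso_twistMod_one_toProj_app_eq_monomialSection`** (Proj form, `φ = D.toProj q`) and
  **`exists_iso_twistMod_one_homEquiv_pointOfSections_app_eq`** (the `𝐏(J; S)` form of ★ `Morphisms/ProjectiveSpaceOverBasePoints`).

## References
* [Hartshorne1977] R. Hartshorne, *Algebraic Geometry* (1977), II Thm. 7.1 (a), (b) (p. 150); II Ex. 5.18; II Prop. 5.12 (p. 117).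
* [MumfordFogartyKirwan1994] D. Mumford, J. Fogarty, F. Kirwan, *Geometric Invariant Theory*, 3rd ed. (1994), Ch. 7 §2 Def. 7.5
  (p. 130) (linear rigidifications read through the embedding they define).
-/

noncomputable section

-- `TopCat.Presheaf`/`Scheme.Modules` are not reducible (as in Mathlib's `AlgebraicGeometry/Modules/Sheaf.lean`).
set_option backward.isDefEq.respectTransparency false

universe u

open CategoryTheory AlgebraicGeometry TopologicalSpace Opposite
open Literature.AlgebraicGeometry.Morphisms Literature.AlgebraicGeometry.Morphisms.ProjCech
open Literature.AlgebraicGeometry.Motives Literature.AlgebraicGeometry.Motives.GeneratingSections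

namespace Literature.AlgebraicGeometry.Modules

/-! ## §1 Frames from a single generating section -/

section SmulFrame

variable {X : Scheme.{u}} {M : X.Modules} {W : X.Opens}

/-- **`r ↦ r • b` is an isomorphism `𝒪|_W ≅ M|_W` as soon as it is bijective on the sections over every open below `W`**
(isomorphisms of sheaves of modules are detected on the underlying presheaves of abelian groups, objectwise).
[cite: Hartshorne1977, II Ex. 5.18] -/
theorem isIso_smulSection_of_bijective (b : Γ(M, W))
    (hb : ∀ ⦃V : X.Opens⦄ (k : V ⟶ W),
      Function.Bijective fun r : Γ(X, V) => (r • M.presheaf.map k.op b : Γ(M, V))) :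
    IsIso (smulSection b) := by
  have : IsIso ((SheafOfModules.forget _ ⋙ PresheafOfModules.toPresheaf _).map (smulSection b)) := by
    rw [NatTrans.isIso_iff_isIso_app]
    intro Y
    rw [ConcreteCategory.isIso_iff_bijective]
    exact hb Y.unop.hom
  exact isIso_of_reflects_iso _ (SheafOfModules.forget _ ⋙ PresheafOfModules.toPresheaf _)

/-- The basis section of the frame `𝒪^{PUnit} ≅ 𝒪|_W ≅ M|_W` obtained from an isomorphism `f : 𝒪|_W ≅ M|_W` is `f(1)`
(★ `one_eq_basisSection_freePUnitIso`; a frame is the choice of basis sections). [cite: Hartshorne1977, II Ex. 5.18] -/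
theorem basisSection_freePUnitIso_trans (f : (unitModule X).over W ≅ M.over W) :
    basisSection (freePUnitIso W ≪≫ f) PUnit.unit = appLE f.hom (𝟙 W) (1 : Γ(X, W)) := by
  rw [basisSection, Iso.trans_hom, SheafOfModules.freeHomEquiv_comp_apply, overSectionsEquiv_sectionsMap']
  change appLE f.hom (𝟙 _) (basisSection (E := unitModule X) (freePUnitIso W) PUnit.unit) = _
  rw [← one_eq_basisSection_freePUnitIso]

/-- **The frame defined by a freely generating section `b` has basis section `b`.** [cite: Hartshorne1977, II Ex. 5.18] -/
theorem basisSection_freePUnitIso_trans_smulSection (b : Γ(M, W)) [IsIso (smulSection b)] :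
    basisSection (freePUnitIso W ≪≫ asIso (smulSection b)) PUnit.unit = b := by
  rw [basisSection_freePUnitIso_trans, asIso_hom, appLE_smulSection, one_smul, presheaf_map_id]

/-- **The `1 × 1` transition matrix of two single-section frames is the ratio of the sections**: if `b'|_V = t • b|_V` then
`T(e_b, e_{b'})|_V = t`. [cite: Hartshorne1977, II Ex. 5.18] -/
theorem transition_smulSection_eq {W' V : X.Opens} (b : Γ(M, W)) (b' : Γ(M, W')) [IsIso (smulSection b)]
    [IsIso (smulSection b')] (k : V ⟶ W) (k' : V ⟶ W') (t : Γ(X, V))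
    (h : M.presheaf.map k'.op b' = t • M.presheaf.map k.op b) :
    transition (freePUnitIso W ≪≫ asIso (smulSection b)) (freePUnitIso W' ≪≫ asIso (smulSection b')) k k'
      PUnit.unit PUnit.unit = t := by
  classical
  have hk : M.presheaf.map k.op b =
      M.presheaf.map k.op (basisSection (freePUnitIso W ≪≫ asIso (smulSection b)) PUnit.unit) := by
    rw [basisSection_freePUnitIso_trans_smulSection]
  rw [transition_apply, basisSection_freePUnitIso_trans_smulSection, h, coord_smul, hk, coord_map_basisSection,
    if_pos rfl, mul_one]

end SmulFrame

/-! ## §2 A unit multiple of the local generator of a rank-one frame generates freely -/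

section RankOne

variable {X : Scheme.{u}} {E : X.Modules} (F : FrameSystem E) (h1 : ∀ x, F.rank x = 1)

/-- **`r ↦ r • b` is bijective on `Γ(X, V) → Γ(E, V)` when `b = c • b_x|_V` with `c` a unit** and `b_x` the local generator of the
rank-one frame system at `x` (`V ⊆ U_x`; coordinates in the frame at `x`, ★ `FrameSystem.eq_coord_smul_gen`).
[cite: Hartshorne1977, II proof of Thm. 7.1 (p. 150)] -/
theorem bijective_smul_of_eq_unit_smul_gen {x : X} {V : X.Opens} (hV : V ≤ F.U x) (b : Γ(E, V)) (c : Γ(X, V))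
    (hc : IsUnit c) (hb : b = c • E.presheaf.map (homOfLE hV).op (basisSection (F.frame x) (F.idx h1 x))) :
    Function.Bijective fun r : Γ(X, V) => (r • b : Γ(E, V)) := by
  classical
  refine ⟨fun r r' hrr' => ?_, fun m => ?_⟩
  · have h := congrArg (fun m : Γ(E, V) => coord (F.frame x) (homOfLE hV) m (F.idx h1 x)) hrr'
    simp only at h
    rw [hb, smul_smul, smul_smul, coord_smul, coord_smul, coord_map_basisSection, if_pos rfl, mul_one,
      mul_one] at h
    exact (IsUnit.mul_left_inj hc).mp h
  · obtain ⟨u, hu⟩ := hc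
    refine ⟨coord (F.frame x) (homOfLE hV) m (F.idx h1 x) * ↑u⁻¹, ?_⟩
    simp only
    rw [hb, smul_smul, mul_assoc, ← hu, Units.inv_mul, mul_one]
    exact (F.eq_coord_smul_gen h1 (homOfLE hV) m).symm

end RankOne

namespace SerreTwist

/-! ## §3 `x_a|_V` generates `𝒪_X(1)` freely on `V ⊆ φ⁻¹D₊(x_a)` -/

section Twist

variable {A : Type u} [CommRing A] {r : ℕ} {Z : Scheme.{u}} (ι : Z ⟶ PP A r)

/-- Two-step restriction of `𝒪_Z` along `V ⊆ V ∩ Z_a ⊆ V` is the identity. [folklore] -/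
private theorem map_map_self {a : Fin (r + 1)} {V : Z.Opens} (hV : V ≤ Zop ι {a}) (d : Γ(Z, V)) :
    Z.presheaf.map (homOfLE (le_inf le_rfl hV : V ≤ V ⊓ Zop ι {a})).op
      (Z.presheaf.map (homOfLE (inf_le_left : V ⊓ Zop ι {a} ≤ V)).op d) = d := by
  rw [← CategoryTheory.comp_apply, ← Functor.map_comp,
    Subsingleton.elim ((homOfLE (inf_le_left : V ⊓ Zop ι {a} ≤ V)).op ≫
      (homOfLE (le_inf le_rfl hV : V ≤ V ⊓ Zop ι {a})).op) (𝟙 _), CategoryTheory.Functor.map_id]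
  rfl

/-- **`c ↦ c • x_a|_V` is bijective `Γ(Z, V) → Γ(𝒪_Z(1), V)` for `V ⊆ Z_a = ι⁻¹D₊(x_a)`**: every section is `n_a • x_a|_V`
((L1) ★ `eq_comp_smul_monomialSection`) and the `a`-th chart piece of `c • x_a|_V` is `c|` (`x_a/x_a = 1`, ★ `chartFun_self`).
[cite: Hartshorne1977, II Prop. 5.12 (p. 117)] -/
theorem bijective_smul_map_monomialSection_one (a : Fin (r + 1)) {V : Z.Opens} (hV : V ≤ Zop ι {a}) :
    Function.Bijective fun c : Γ(Z, V) => (c • (twistMod ι (unitModule Z) 1).presheaf.map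
      (homOfLE (le_top : V ≤ ⊤)).op (monomialSection ι 1 (fun _ : Fin 1 => a)) : Γ(twistMod ι (unitModule Z) 1, V)) := by
  -- the `a`-th chart piece of `x_a|_V` is `1`
  have h1a : (show Γ(Z, V ⊓ Zop ι {a}) from comp ι (unitModule Z) ((twistMod ι (unitModule Z) 1).presheaf.map
      (homOfLE (le_top : V ≤ ⊤)).op (monomialSection ι 1 (fun _ : Fin 1 => a))) a) = 1 := by
    rw [comp_map]
    change Z.presheaf.map _ (show Γ(Z, ⊤ ⊓ Zop ι {a}) from comp ι (unitModule Z) (monomialSection ι 1 _) a) = 1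
    rw [comp_monomialSection_eq_map_wordFun, wordFun_const', chartFun_self, one_pow, map_one, map_one]
  refine ⟨fun c c' hcc' => ?_, fun n => ⟨_, (eq_comp_smul_monomialSection ι hV n).symm⟩⟩
  have h0 := congrArg (fun n => (show Γ(Z, V ⊓ Zop ι {a}) from comp ι (unitModule Z) n a)) hcc'
  simp only at h0
  rw [comp_smul, comp_smul] at h0
  change Z.presheaf.map _ c * (show Γ(Z, V ⊓ Zop ι {a}) from comp ι (unitModule Z) _ a) =
    Z.presheaf.map _ c' * (show Γ(Z, V ⊓ Zop ι {a}) from comp ι (unitModule Z) _ a) at h0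
  rw [h1a, mul_one, mul_one] at h0
  have e := congrArg (Z.presheaf.map (homOfLE (le_inf le_rfl hV : V ≤ V ⊓ Zop ι {a})).op) h0
  rw [map_map_self ι hV, map_map_self ι hV] at e
  exact e

/-- **`x_i|_V = (x_i/x_a)|_V • x_a|_V`** in `Γ(V, 𝒪_Z(1))` for `V ⊆ Z_a` ((L1) ★ `map_monomialSection_one_eq_chartFun_smul` restricted).
[cite: Hartshorne1977, II Prop. 5.12 (p. 117)] -/
theorem map_monomialSection_one_eq_map_chartFun_smul' (i a : Fin (r + 1)) {V : Z.Opens} (hV : V ≤ Zop ι {a}) :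
    (twistMod ι (unitModule Z) 1).presheaf.map (homOfLE (le_top : V ≤ ⊤)).op (monomialSection ι 1 (fun _ : Fin 1 => i)) =
      Z.presheaf.map (homOfLE hV).op (chartFun ι i a) •
        (twistMod ι (unitModule Z) 1).presheaf.map (homOfLE (le_top : V ≤ ⊤)).op
          (monomialSection ι 1 (fun _ : Fin 1 => a)) := by
  rw [← moduleMap_map_apply (twistMod ι (unitModule Z) 1) (le_top : Zop ι {a} ≤ ⊤) hV,
    map_monomialSection_one_eq_chartFun_smul, Scheme.Modules.map_smul, moduleMap_map_apply]

end Twist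

/-! ## §4 The isomorphism `E ≅ 𝒪_X(1)` with `s_i ↦ x_i` -/

section Iso

variable {A : Type u} [CommRing A] {r : ℕ} {X : Scheme.{u}} {E : X.Modules}
  (F : FrameSystem E) (h1 : ∀ x, F.rank x = 1) (s : Fin (r + 1) → Γ(E, ⊤))

/-- **`s_i|_V = (x_i/x_a)|_V • s_a|_V`** on `V ⊆ U_x ∩ φ⁻¹D₊(x_a)`, from the ratio hypothesis `φ^*(x_i/x_a) · (s_a)_x = (s_i)_x` of the
criterion (★ `map_top_eq_map_coeffAt_smul`). [cite: Hartshorne1977, II Thm. 7.1 (b) (p. 150)] -/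
theorem map_top_eq_map_chartFun_smul (φ : X ⟶ PP A r)
    (hrat : ∀ (i a : Fin (r + 1)) (y : X) (V : X.Opens) (hy : V ≤ F.U y) (ha : V ≤ Zop φ {a}),
      secRes X ha (chartFun φ i a) * secRes X hy (coeffAt F h1 s a y) = secRes X hy (coeffAt F h1 s i y))
    (i a : Fin (r + 1)) (x : X) {V : X.Opens} (hx : V ≤ F.U x) (ha : V ≤ Zop φ {a}) :
    E.presheaf.map (homOfLE (le_top : V ≤ ⊤)).op (s i) =
      X.presheaf.map (homOfLE ha).op (chartFun φ i a) • E.presheaf.map (homOfLE (le_top : V ≤ ⊤)).op (s a) := by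
  rw [map_top_eq_map_coeffAt_smul F h1 s i x hx, map_top_eq_map_coeffAt_smul F h1 s a x hx, smul_smul]
  congr 1
  exact (hrat i a x V hx ha).symm

/-- **HEAD (criterion form).  `E ≅ 𝒪_X(1) = twistMod φ 𝒪_X 1` BY AN ISOMORPHISM SENDING `s_i` TO `x_i|_X`**, under the hypotheses of
★ `nonempty_iso_twistMod_one_of_coeffAt` (loci, pointwise generation, ratios).  Proof: on `W_x = φ⁻¹D₊(x_{j x}) ∩ U_x` the sections
`s_{j x}|` of `E` (§2) and `x_{j x}|` of `𝒪_X(1)` (§3) are single-section frames with the SAME transition function `x_{j y}/x_{j x}`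
(§1 `transition_smulSection_eq`), so ★ `isoOfFrames` glues the local isomorphisms `s_{j x}| ↦ x_{j x}|` ([Hartshorne1977] II
Ex. 5.18 (c)); then `s_i| = (x_i/x_{j x})| • s_{j x}| ↦ (x_i/x_{j x})| • x_{j x}| = x_i|` on every `W_x`, and sections of a sheaf
agreeing on a cover are equal. [cite: Hartshorne1977, II Thm. 7.1 (a) (p. 150)] [cite: Hartshorne1977, II Ex. 5.18] -/
theorem exists_iso_twistMod_one_of_coeffAt (φ : X ⟶ PP A r)
    (hZ : ∀ (i : Fin (r + 1)) (x : X), Zop φ {i} ⊓ F.U x = X.basicOpen (coeffAt F h1 s i x))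
    (hgen : ∀ p : X, ∃ i, p ∈ X.basicOpen (coeffAt F h1 s i p))
    (hrat : ∀ (i a : Fin (r + 1)) (y : X) (V : X.Opens) (hy : V ≤ F.U y) (ha : V ≤ Zop φ {a}),
      secRes X ha (chartFun φ i a) * secRes X hy (coeffAt F h1 s a y) = secRes X hy (coeffAt F h1 s i y)) :
    ∃ e : E ≅ twistMod φ (unitModule X) 1, ∀ i, e.hom.app ⊤ (s i) = monomialSection φ 1 (fun _ : Fin 1 => i) := by
  classical
  -- a chart choice `x ↦ j x` with `(s_{j x})_x(x) ≠ 0`, hence `x ∈ φ⁻¹D₊(x_{j x})`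
  choose j hj using hgen
  have hjZ : ∀ x, x ∈ Zop φ {j x} := fun x => by
    have hx : x ∈ Zop φ {j x} ⊓ F.U x := by rw [hZ]; exact hj x
    exact hx.1
  -- the coefficient `(s_{j x})_x` is a unit on every open below `W_x = φ⁻¹D₊(x_{j x}) ∩ U_x = X_{(s_{j x})_x}`
  have hunit : ∀ (x : X) (V : X.Opens) (hV : V ≤ Zop φ {j x} ⊓ F.U x),
      IsUnit (secRes X (hV.trans inf_le_right) (coeffAt F h1 s (j x) x)) := fun x V hV => by
    have hB : V ≤ X.basicOpen (coeffAt F h1 s (j x) x) := by rw [← hZ]; exact hV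
    exact isUnit_map_of_le_basicOpen _ hB
  -- the single-section frames `s_{j x}|_{W_x}` of `E` …
  have hbE : ∀ x : X, IsIso (smulSection
      (E.presheaf.map (homOfLE (le_top : Zop φ {j x} ⊓ F.U x ≤ ⊤)).op (s (j x)))) := fun x =>
    isIso_smulSection_of_bijective _ fun V k => by
      have hk : V ≤ Zop φ {j x} ⊓ F.U x := k.le
      rw [presheaf_map_map, Subsingleton.elim (k ≫ homOfLE (le_top : Zop φ {j x} ⊓ F.U x ≤ ⊤))
        (homOfLE (le_top : V ≤ ⊤))]
      exact bijective_smul_of_eq_unit_smul_gen F h1 (hk.trans inf_le_right) _ _ (hunit x V hk)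
        (map_top_eq_map_coeffAt_smul F h1 s (j x) x (hk.trans inf_le_right))
  -- … and `x_{j x}|_{W_x}` of `𝒪_X(1)`
  have hbL : ∀ x : X, IsIso (smulSection ((twistMod φ (unitModule X) 1).presheaf.map
      (homOfLE (le_top : Zop φ {j x} ⊓ F.U x ≤ ⊤)).op (monomialSection φ 1 (fun _ : Fin 1 => j x)))) := fun x =>
    isIso_smulSection_of_bijective _ fun V k => by
      have hk : V ≤ Zop φ {j x} ⊓ F.U x := k.le
      rw [presheaf_map_map, Subsingleton.elim (k ≫ homOfLE (le_top : Zop φ {j x} ⊓ F.U x ≤ ⊤))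
        (homOfLE (le_top : V ≤ ⊤))]
      exact bijective_smul_map_monomialSection_one φ (j x) (hk.trans inf_le_left)
  let W : X → X.Opens := fun x => Zop φ {j x} ⊓ F.U x
  let eE : ∀ x : X, SheafOfModules.free (PUnit : Type u) ≅ E.over (W x) := fun x =>
    freePUnitIso (W x) ≪≫ asIso (smulSection (E.presheaf.map (homOfLE (le_top : Zop φ {j x} ⊓ F.U x ≤ ⊤)).op (s (j x))))
  let eL : ∀ x : X, SheafOfModules.free (PUnit : Type u) ≅ (twistMod φ (unitModule X) 1).over (W x) := fun x =>
    freePUnitIso (W x) ≪≫ asIso (smulSection ((twistMod φ (unitModule X) 1).presheaf.map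
      (homOfLE (le_top : Zop φ {j x} ⊓ F.U x ≤ ⊤)).op (monomialSection φ 1 (fun _ : Fin 1 => j x))))
  -- equal transition functions `x_{j y}/x_{j x}` on `W_x ∩ W_y`
  have hT : ∀ x y : X, transition (eE x) (eE y) (Opens.infLELeft (W x) (W y)) (Opens.infLERight (W x) (W y)) =
      transition (eL x) (eL y) (Opens.infLELeft (W x) (W y)) (Opens.infLERight (W x) (W y)) := fun x y => by
    have hV1 : W x ⊓ W y ≤ F.U x := inf_le_left.trans inf_le_right
    have hV2 : W x ⊓ W y ≤ Zop φ {j x} := inf_le_left.trans inf_le_left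
    have tE : transition (eE x) (eE y) (Opens.infLELeft (W x) (W y)) (Opens.infLERight (W x) (W y))
        PUnit.unit PUnit.unit = X.presheaf.map (homOfLE hV2).op (chartFun φ (j y) (j x)) := by
      refine transition_smulSection_eq _ _ _ _ _ ?_
      rw [presheaf_map_map, presheaf_map_map,
        Subsingleton.elim (Opens.infLERight (W x) (W y) ≫ homOfLE (le_top : Zop φ {j y} ⊓ F.U y ≤ ⊤))
          (homOfLE (le_top : W x ⊓ W y ≤ ⊤)),
        Subsingleton.elim (Opens.infLELeft (W x) (W y) ≫ homOfLE (le_top : Zop φ {j x} ⊓ F.U x ≤ ⊤))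
          (homOfLE (le_top : W x ⊓ W y ≤ ⊤))]
      exact map_top_eq_map_chartFun_smul F h1 s φ hrat (j y) (j x) x hV1 hV2
    have tL : transition (eL x) (eL y) (Opens.infLELeft (W x) (W y)) (Opens.infLERight (W x) (W y))
        PUnit.unit PUnit.unit = X.presheaf.map (homOfLE hV2).op (chartFun φ (j y) (j x)) := by
      refine transition_smulSection_eq _ _ _ _ _ ?_
      rw [presheaf_map_map, presheaf_map_map,
        Subsingleton.elim (Opens.infLERight (W x) (W y) ≫ homOfLE (le_top : Zop φ {j y} ⊓ F.U y ≤ ⊤))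
          (homOfLE (le_top : W x ⊓ W y ≤ ⊤)),
        Subsingleton.elim (Opens.infLELeft (W x) (W y) ≫ homOfLE (le_top : Zop φ {j x} ⊓ F.U x ≤ ⊤))
          (homOfLE (le_top : W x ⊓ W y ≤ ⊤))]
      exact map_monomialSection_one_eq_map_chartFun_smul' φ (j y) (j x) hV2
    refine Matrix.ext fun l l' => ?_
    obtain ⟨⟩ := l
    obtain ⟨⟩ := l'
    rw [tE, tL]
  have hWtop : iSup W = ⊤ := eq_top_iff.mpr fun x _ => Opens.mem_iSup.mpr ⟨x, ⟨hjZ x, F.mem x⟩⟩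
  refine ⟨isoOfFrames W eE eL hT hWtop, fun i => ?_⟩
  -- `s_i ↦ x_i`: check on every `W_x`
  refine TopCat.Sheaf.eq_of_locally_eq'
    (⟨(twistMod φ (unitModule X) 1).presheaf, (twistMod φ (unitModule X) 1).isSheaf⟩ : TopCat.Sheaf Ab X)
    W ⊤ (fun x => homOfLE le_top) hWtop.ge _ _ fun x => ?_
  change (twistMod φ (unitModule X) 1).presheaf.map (homOfLE (le_top : W x ≤ ⊤)).op
      ((isoOfFrames W eE eL hT hWtop).hom.app ⊤ (s i)) =
    (twistMod φ (unitModule X) 1).presheaf.map (homOfLE (le_top : W x ≤ ⊤)).op (monomialSection φ 1 (fun _ : Fin 1 => i))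
  rw [hom_map_app, isoOfFrames_hom_app W eE eL hT hWtop x (𝟙 (W x)),
    map_top_eq_map_chartFun_smul F h1 s φ hrat i (j x) x (inf_le_right : W x ≤ F.U x) (inf_le_left : W x ≤ Zop φ {j x}),
    appLE_smul_right,
    show E.presheaf.map (homOfLE (le_top : W x ≤ ⊤)).op (s (j x)) = basisSection (eE x) PUnit.unit from
      (basisSection_freePUnitIso_trans_smulSection _).symm,
    appLE_frameComp_basisSection, basisSection_freePUnitIso_trans_smulSection]
  exact (map_monomialSection_one_eq_map_chartFun_smul' φ i (j x) (inf_le_left : W x ≤ Zop φ {j x})).symm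

variable (hcov : ⨆ i, ⨆ x, X.basicOpen ((CocycleSections.ofFrameSystem F h1 s).coeff i x) = ⊤) (q : X ⟶ Spec (.of A))

/-- **HEAD (Proj form).  [Hartshorne1977] II Thm. 7.1 (a) with its section clause**: for a rank-one frame system `F` of `E`, global
sections `s₀, …, s_r` whose non-vanishing loci cover, and `φ := (ofCocycleSections F.U (ofFrameSystem F h1 s) hcov).toProj q : X → 𝐏ʳ_A`
the morphism they define, there is an isomorphism `E ≅ 𝒪_X(1) = twistMod φ 𝒪_X 1` sending `s_i` to `x_i|_X = monomialSection φ 1 (i)`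
(criterion at the ★ facts `Zop_toProj_inf_eq_basicOpen_coeffAt`, `secRes_chartFun_toProj_mul_coeffAt`).
[cite: Hartshorne1977, II Thm. 7.1 (a) (p. 150)] [cite: MumfordFogartyKirwan1994, Ch. 7 §2 Def. 7.5 (p. 130)] -/
theorem exists_iso_twistMod_one_toProj_app_eq_monomialSection :
    ∃ e : E ≅ twistMod ((ofCocycleSections F.U (CocycleSections.ofFrameSystem F h1 s) hcov).toProj q) (unitModule X) 1,
      ∀ i, e.hom.app ⊤ (s i) =
        monomialSection ((ofCocycleSections F.U (CocycleSections.ofFrameSystem F h1 s) hcov).toProj q) 1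
          (fun _ : Fin 1 => i) :=
  exists_iso_twistMod_one_of_coeffAt F h1 s _ (Zop_toProj_inf_eq_basicOpen_coeffAt F h1 s hcov q)
    ((iSup_basicOpen_coeffAt_eq_top_iff F h1 s).mp hcov)
    (fun i a y _ hy ha => secRes_chartFun_toProj_mul_coeffAt F h1 s hcov q i a y hy ha)

end Iso

/-- **HEAD (`𝐏(J; S)` form).**  The same for the `S`-point ★ `Morphisms.projectiveSpace.pointOfSections (Over.mk q) D` of `𝐏(J; S)`
read back as `X → 𝐏ⁿ_ℤ` by ★ `homEquiv` (the shape ★ `PolarizedAbelianSchemeWithLevel.IsFrameRigidification` ends in): an isomorphism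
`E ≅ 𝒪_X(1)` along it sending `s_i` to `x_i|_X` (★ `homEquiv_pointOfSections` + the Proj form over `ℤ`).
[cite: Hartshorne1977, II Thm. 7.1 (a) (p. 150)] [cite: MumfordFogartyKirwan1994, Ch. 7 §2 Def. 7.5 (p. 130)] -/
theorem exists_iso_twistMod_one_homEquiv_pointOfSections_app_eq {J : Type u} [Finite J] {X S : Scheme.{u}}
    (q : X ⟶ S) {E : X.Modules} (F : FrameSystem E) (h1 : ∀ x, F.rank x = 1) (s : Fin (Nat.card J + 1) → Γ(E, ⊤))
    (hcov : ⨆ i, ⨆ x, X.basicOpen ((CocycleSections.ofFrameSystem F h1 s).coeff i x) = ⊤) :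
    ∃ e : E ≅ twistMod (Morphisms.projectiveSpace.homEquiv (ι := J) (Over.mk q)
      (Morphisms.projectiveSpace.pointOfSections (Over.mk q)
        (ofCocycleSections F.U (CocycleSections.ofFrameSystem F h1 s) hcov))) (unitModule X) 1,
      ∀ i, e.hom.app ⊤ (s i) = monomialSection (Morphisms.projectiveSpace.homEquiv (ι := J) (Over.mk q)
        (Morphisms.projectiveSpace.pointOfSections (Over.mk q)
          (ofCocycleSections F.U (CocycleSections.ofFrameSystem F h1 s) hcov))) 1 (fun _ : Fin 1 => i) := by
  rw [Morphisms.projectiveSpace.homEquiv_pointOfSections]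
  exact exists_iso_twistMod_one_toProj_app_eq_monomialSection F h1 s hcov _

end SerreTwist

end Literature.AlgebraicGeometry.Modules

end
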